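import Summits.HodgeConjecture.HodgeConjecture.Theorems.F0P6aStubDOWNSpecKey
import HarnessLib

/-!
# `F0P6aStubDOWNSpecHeads` — ★ RE-HOME of `Lines/F0_P6a_StubDOWN.lean`, PART 4 of 7 (size-lint split; cut at a declaration boundary).

Imports: ★ `Theorems.F0P6aStubDOWNSpecKey` = the previous part of the same Lines workfile `F0_P6a_StubDOWN` (size-lint split ×7) + `HarnessLib` (canonical header: bare `import` lines).
See PART 1 `Theorems/F0P6aStubDOWNLaws.lean` for the full re-home header and the original module docstring (verbatim there). Namespaces and sections KEPT
(re-opened below exactly as they stand at the cut, with their `open`∕`variable` lines replayed); code bytes = the workfile՚s, docstrings included; options preamble repeated from PART 1.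
HC_CM is proved only modulo the 7 printed citations (2 remaining: hLiu418 = stmt-HodgeConjecture-24832, h413 = stmt-HodgeConjecture-24833) until rung 0 closes; a re-home is count-neutral. -/

set_option autoImplicit false
set_option linter.dupNamespace false

noncomputable section

namespace Summit.HodgeConjecture.HodgeConjecture.Cruxes.HLiu418.F0P6aStubDOWN
open CategoryTheory CategoryTheory.Limits NumberField IsDedekindDomain MulAction
open scoped Matrix Polynomial Pointwise MonoidalCategory
open Literature.NumberTheory.GaloisRepresentations
open Literature.NumberTheory.Automorphic Literature.NumberTheory.Automorphic.UnitaryGroup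
open Literature.AlgebraicGeometry.ShimuraVarieties.UnitaryCanonicalModel
open Literature.NumberTheory.Automorphic.Liu2021.AppendixC
open Literature.AlgebraicGeometry.Motives (AlgPoints IntegralModel SchemeOver thickening thickeningGalAction thickeningLift specOver relFrobeniusOver frobeniusTwistOver)
open Literature.NumberTheory.DiophantineGeometry (geomResidueField specialFibreFunctor specResidueField)
open Literature.AlgebraicGeometry.RelativeSpec (ActionOver)
open Literature.NumberTheory.EllipticCurves (genericFibre)
open Literature.AlgebraicGeometry.GroupSchemes.AffineGroupScheme (Alg quotIncl)
open Summit.HodgeConjecture.HodgeConjecture.Cruxes.HLiu418.F0P6cDictConstructors (kerFI AdmSub IdealIsEtale isAdm_kerFI)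
open Summit.HodgeConjecture.HodgeConjecture.Cruxes.HLiu418.F0P6aModuliDatumDefs
open Summit.HodgeConjecture.HodgeConjecture.Cruxes.HLiu418.F0P6aRGDAssembly
open Summit.HodgeConjecture.HodgeConjecture.Cruxes.HLiu418.F0P6aDatumOfInputs
open Summit.HodgeConjecture.HodgeConjecture.Cruxes.HLiu418.F0P6aLineSpecialisation (spGeoOf canonicalLine_spGeoOf spGeoOf_surjective hrkG_of_dock
  exists_isogW₀_of_quotLeg mono_coverPin₀ le_ker_isogW₀_of_himg red₀Of_translΩ_eq_of_red₀Of_eq red₀Of_quotΩ_eq_red₀Of_translΩ_of_le_ker_layer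
  red₀Of_quotΩ_eq_of_quotLegReduction₀)  -- [ED. 4] organ heads BY NAME (incl. the §Q head `red₀Of_quotΩ_eq_of_quotLegReduction₀`, PART B)

section SpecAssembly
open AlgebraicGeometry
open Literature.AlgebraicGeometry.AbelianSchemes Literature.AlgebraicGeometry.AbelianSchemes.AbelianSchemeOver
open Summit.HodgeConjecture.HodgeConjecture.Cruxes.HLiu418.F0P6aLineSpecialisation (spGeoOf canonicalLine_spGeoOf spGeoOf_surjective)
open scoped MonObj CategoryTheory.Obj
variable {F : Type} [Field F] [NumberField F] [IsCMField F] {ι₁ : F →+* ℂ}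
    {Jstar : Matrix (Fin 2) (Fin 2) F}
    {K₀ : C5.OpenCompactSubgroup ↥(finAdelic ↥(maximalRealSubfield F) F (IsCMField.complexConj F) 2 Jstar)}
    {S : RecordSystemGS F Jstar ι₁ K₀} {hU7ₛ : S.HeckeTranslateDefinedOver}
    {hJ : (Jstar.map (IsCMField.complexConj F))ᵀ = Jstar} {hJu : IsUnit Jstar}
    {Fi : Type} [Field Fi] [Algebra F Fi] {Kc : C5.SmallLevel K₀} {G : Type} [Group G]
    {𝓜 : IntegralModel (𝓞 F) F ((thickening F Fi).obj (S.M.obj Kc))}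
    {w : HeightOneSpectrum (𝓞 F)} {hw : (IsCMField.complexConj F) • w ≠ w} {h𝓨 : (𝓜.localise w).IsSmoothProper 1}
    {θ : ActionOver (𝓜.localise w).total.hom ((Fi ≃ₐ[F] Fi) × G)}
    {e : Fi →ₐ[F] AlgebraicClosure (w.adicCompletion F)}


set_option maxHeartbeats 400000 in
/-- **(Σ) `stub_SPEC_of_heads` — THE ORGAN `stub_SPEC` OVER THE HEADS** (leaf ED. 3 :474 body VERBATIM as conclusion; heads as function-binders, see the module
docstring for the producer ↦ binder ↦ fold-term table, the bookkeeping and the letter questions).  [cite: Liu2021, Prop. D.8 p. 135, pp. 136–138]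
[cite: Tate1997FiniteFlatGroupSchemes, (3.7)] [cite: Carayol1986Compositio, §10.3 Prop. p. 211] [cite: Kottwitz1992, §5, p. 391] [cite: SerreTate1968, §1 Lemma 2] -/
theorem stub_SPEC_of_heads (I : RGDInputsAt F ι₁ Jstar K₀ S hU7ₛ hJ hJu Fi Kc G 𝓜 w hw h𝓨 θ e) [ExpChar (geomResidueField w) I.pChar]
    [IsCommMonObj I.univ.X] -- (= `I.comm`; binder-position instance for the `serreTensor` tokens of the head texts; a `Prop`, so `haveI := I.comm` at fold)
    (𝔡 : ∀ xbar, DockAt I xbar)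
    (quotΩ : ∀ y, LineOf I y → AlgPoints (S.M.obj Kc) (AlgebraicClosure (w.adicCompletion F)))
    (translΩ : AlgPoints (S.M.obj Kc) (AlgebraicClosure (w.adicCompletion F)) → AlgPoints (S.M.obj Kc) (AlgebraicClosure (w.adicCompletion F)))
    (hhecke : HeckeClause I quotΩ translΩ) (hroof : RoofLink I quotΩ) (hroof₂ : RoofLink₂ I translΩ)
    (hunit : (UnitaryGroup.isUnit_placeForm Jstar hJu w).unit ∈ glInt 2 (w.adicCompletion F))
    (hKc : UnitaryGroup.IsHyperspecialAt ↥(maximalRealSubfield F) F (IsCMField.complexConj F) 2 Jstar Kc.1.1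
      (w.under (𝓞 ↥(maximalRealSubfield F))))
    -- ═════ (ρ1𝒞) HEAD `exists_quotLegReduction` v3-to-be (LA1-p01 (g3) v2 dd38f771 :303 binders VERBATIM; rows := [WQ] `hdat` rows VERBATIM ((FLAT-SURJ)(ACT)(LVL)(SIM)(K2-gen)(RK)(KILL)(DOCK),
    --        DOCK parenthesised) ∧ (IMG) SHAPE (a) LAST — LA2-plan (g2) 09:18:21Z (2) (Q-IMG) YES).  Fed at fold by `exists_quotLegReduction I`.
    (hρ1 : ∀ (𝔡 : ∀ xbar, DockAt I xbar)
      -- SOCKET ORDER OF RECORD (LA2-plan (g2) 09:29:54Z (1)): `𝔡 quotΩ translΩ hhecke hroof hroof₂ hunit hKc`, THEN the Serre letters, THEN `(y) (L)`; no `hunr`∕`hpN` head binders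
      (quotΩ : ∀ y, LineOf I y → AlgPoints (S.M.obj Kc) (AlgebraicClosure (w.adicCompletion F)))
      (translΩ : AlgPoints (S.M.obj Kc) (AlgebraicClosure (w.adicCompletion F)) → AlgPoints (S.M.obj Kc) (AlgebraicClosure (w.adicCompletion F)))
      (hhecke : HeckeClause I quotΩ translΩ) (hroof : RoofLink I quotΩ) (hroof₂ : RoofLink₂ I translΩ)
      (hunit : (UnitaryGroup.isUnit_placeForm Jstar hJu w).unit ∈ glInt 2 (w.adicCompletion F))
      (hKc : UnitaryGroup.IsHyperspecialAt ↥(maximalRealSubfield F) F (IsCMField.complexConj F) 2 Jstar Kc.1.1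
        (w.under (𝓞 ↥(maximalRealSubfield F))))
      {m : ℕ} (E' : Matrix (Fin m) (Fin m) (𝓞 F)) (hE' : E' * E' = E') (P : Matrix (Fin m) (Fin 1) (𝓞 F)) (Q : Matrix (Fin 1) (Fin m) (𝓞 F))
      (hP : E' * P = P) (hQ : Q * E' = Q) (hQP : Q * P = Matrix.scalar (Fin 1) (I.pChar : 𝓞 F))
      (hPQ : P * Q = Matrix.scalar (Fin m) (I.pChar : 𝓞 F) * E') (h𝔭 : Ideal.span (Set.range fun k => P k 0) = w.asIdeal)
      (y : AlgPoints (S.M.obj Kc) (AlgebraicClosure (w.adicCompletion F))) (L : LineOf I y),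
      haveI := I.comm
      letI := (𝔡 (red₀Of S Kc 𝓜 w h𝓨 e y)).grp₀
      haveI := (𝔡 (red₀Of S Kc 𝓜 w h𝓨 e y)).aff₀
        ∃ (ψ : (sch₀Of 𝓜 w I.univ (red₀Of S Kc 𝓜 w h𝓨 e y)).X ⟶ (sch₀Of 𝓜 w (serreTensor I.act E' hE') (red₀Of S Kc 𝓜 w h𝓨 e (quotΩ y L))).X) (_ : IsMonHom ψ),
          -- (FLAT-SURJ)
          (Flat ψ.left ∧ Function.Surjective ψ.left.base) ∧
          -- (ACT) `𝒪_F`-equivariance, `act₀Of` currency on both sides (`serreAction` on `𝒞`)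
          (∀ a : 𝓞 F, (act₀Of 𝓜 w I.univ I.act a (red₀Of S Kc 𝓜 w h𝓨 e y)).hom.hom.hom ≫ ψ =
            ψ ≫ (act₀Of 𝓜 w (serreTensor I.act E' hE') (serreAction I.act E' hE') a (red₀Of S Kc 𝓜 w h𝓨 e (quotΩ y L))).hom.hom.hom) ∧
          -- (LVL) level points: `ψ(σᵃ(x̄)) = (σᵃ ≫ ψ_P)(x̄″)`
          (∀ a : Fin I.g ⊕ Fin I.g → ZMod I.N,
            AlgPoints.map ψ (lvlPt₀Of 𝓜 w I.univ I.lvl (red₀Of S Kc 𝓜 w h𝓨 e y) a) =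
              ((serreTensor I.act E' hE').baseChange (pullback.fst (𝓜.localise w).total.hom (specResidueField w))).restrictPt (red₀Of S Kc 𝓜 w h𝓨 e (quotΩ y L)).left
                ((serreTensor I.act E' hE').sectionBaseChange (pullback.fst (𝓜.localise w).total.hom (specResidueField w)) (I.lvl.section_ a ≫ serreTranslate I.act E' hE' P))) ∧
          -- (SIM) for EVERY downstairs dual pair of `𝒞_{x̄″}` through which the cover leg pulls back to `λ ≫ [p]`: `ψ^* λ_B̄ = λ_{x̄} ≫ [p]`
          (∀ (DBs : (sch₀Of 𝓜 w (serreTensor I.act E' hE') (red₀Of S Kc 𝓜 w h𝓨 e (quotΩ y L))).DualPair)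
            (_ : Nonempty ((Scheme.Modules.pullback (DualPair.unitHatSlice DBs)).obj DBs.P ≅ SheafOfModules.unit _))
            (lamBs : (sch₀Of 𝓜 w (serreTensor I.act E' hE') (red₀Of S Kc 𝓜 w h𝓨 e (quotΩ y L))).X ⟶ DBs.hat.X) [IsMonHom lamBs],
            (haveI := isMonHom_coverLeg (pullback.fst (𝓜.localise w).total.hom (specResidueField w)) (red₀Of S Kc 𝓜 w h𝓨 e (quotΩ y L)).left I.act E' hE' P
             baseChangeHom (baseChangeHom (serreTranslate I.act E' hE' P) (pullback.fst (𝓜.localise w).total.hom (specResidueField w))) (red₀Of S Kc 𝓜 w h𝓨 e (quotΩ y L)).left ≫ lamBs ≫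
                DualPair.dualIsogenyOver (baseChangeHom (baseChangeHom (serreTranslate I.act E' hE' P) (pullback.fst (𝓜.localise w).total.hom (specResidueField w))) (red₀Of S Kc 𝓜 w h𝓨 e (quotΩ y L)).left)
                  (dual₀Of 𝓜 w I.univ I.dual (red₀Of S Kc 𝓜 w h𝓨 e (quotΩ y L))) DBs =
              (pol₀Of 𝓜 w I.univ I.pol (red₀Of S Kc 𝓜 w h𝓨 e (quotΩ y L))).lam ≫ (dual₀Of 𝓜 w I.univ I.dual (red₀Of S Kc 𝓜 w h𝓨 e (quotΩ y L))).hat.mulN I.pChar) →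
            ψ ≫ lamBs ≫ DualPair.dualIsogenyOver ψ (dual₀Of 𝓜 w I.univ I.dual (red₀Of S Kc 𝓜 w h𝓨 e y)) DBs =
              (pol₀Of 𝓜 w I.univ I.pol (red₀Of S Kc 𝓜 w h𝓨 e y)).lam ≫ (dual₀Of 𝓜 w I.univ I.dual (red₀Of S Kc 𝓜 w h𝓨 e y)).hat.mulN I.pChar) ∧
          -- (K2-gen) every ideal bound on the kernel descends: `Ker q(Ω̄) ⊆ A_y[𝔞](Ω̄)` for the upstairs leg is recorded through `L`'s roof, so downstairs:
          (∀ 𝔞 : Ideal (𝓞 F), (∀ Pt ∈ L.1, IsIdealTorsionΩ S Kc 𝓜 w e I.univ I.act y 𝔞 Pt) →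
            (∀ Pt : (fibreΩOf S Kc 𝓜 w e I.univ y).Points (AlgebraicClosure (w.adicCompletion F)),
              (∀ r ∈ w.asIdeal * ((IsCMField.complexConj F) • w).asIdeal, (AlgPoints.map (actΩOf S Kc 𝓜 w e I.univ I.act r y).hom.hom.hom Pt :
                (fibreΩOf S Kc 𝓜 w e I.univ y).Points (AlgebraicClosure (w.adicCompletion F))) = 1) → IsIdealTorsionΩ S Kc 𝓜 w e I.univ I.act y 𝔞 Pt) →
            ∀ ⦃T : SchemeOver (geomResidueField w)⦄ (z : T ⟶ (sch₀Of 𝓜 w I.univ (red₀Of S Kc 𝓜 w h𝓨 e y)).X),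
              z ≫ ψ = 1 → ∀ r ∈ 𝔞, z ≫ (act₀Of 𝓜 w I.univ I.act r (red₀Of S Kc 𝓜 w h𝓨 e y)).hom.hom.hom = 1) ∧
          -- (RK) the rank of `Ker ψ`, BY VALUE for every closed realisation (LA2-p04 (g2) (C6′) `hrkᵢ` text)
          (∀ (K : SchemeOver (geomResidueField w)) [GrpObj K] [IsAffine K.left] [Module.Finite (geomResidueField w) (Alg K)]
            (κ : K ⟶ (sch₀Of 𝓜 w I.univ (red₀Of S Kc 𝓜 w h𝓨 e y)).X) [IsMonHom κ] [IsClosedImmersion κ.left],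
            (∀ ⦃T : SchemeOver (geomResidueField w)⦄ (t : T ⟶ (sch₀Of 𝓜 w I.univ (red₀Of S Kc 𝓜 w h𝓨 e y)).X), (∃ s : T ⟶ K, s ≫ κ = t) ↔ t ≫ ψ = 1) →
            Module.finrank (geomResidueField w) (Alg K) = I.pChar ^ I.fDeg * I.pChar ^ I.fDeg) ∧
          -- (KILL) `ψ` kills `V(spGeoOf y L) ↪ G₀(x̄) ↪ A_{x̄}`
          quotIncl (𝔡 (red₀Of S Kc 𝓜 w h𝓨 e y)).G₀ (spGeoOf I 𝔡 y L).1 ≫ (𝔡 (red₀Of S Kc 𝓜 w h𝓨 e y)).ι₀G ≫ ψ = 1 ∧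
          -- (DOCK) `Ker ψ ∩ G₀(x̄) = V(spGeoOf y L)` on all `T`-points of the dock
          (∀ ⦃T : SchemeOver (geomResidueField w)⦄ (t : T ⟶ (𝔡 (red₀Of S Kc 𝓜 w h𝓨 e y)).G₀),
            t ≫ (𝔡 (red₀Of S Kc 𝓜 w h𝓨 e y)).ι₀G ≫ ψ = 1 ↔
              ∃ s : T ⟶ specOver (geomResidueField w) (Alg (𝔡 (red₀Of S Kc 𝓜 w h𝓨 e y)).G₀ ⧸ (spGeoOf I 𝔡 y L).1),
                s ≫ quotIncl (𝔡 (red₀Of S Kc 𝓜 w h𝓨 e y)).G₀ (spGeoOf I 𝔡 y L).1 = t) ∧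
          -- (IMG) row, SHAPE (a) of record (LA2-plan (g2) 09:18:21Z (2)): the BACKTRACKING line `L_b` with `himg` (LA2-p03 (g3) f3424bb3 :279–:285 text at `H″ := spGeoOf I 𝔡 (quotΩ y L) L_b`)
          ∃ Lb : LineOf I (quotΩ y L), quotΩ (quotΩ y L) Lb = translΩ y ∧
            (letI := (𝔡 (red₀Of S Kc 𝓜 w h𝓨 e (quotΩ y L))).grp₀; haveI := (𝔡 (red₀Of S Kc 𝓜 w h𝓨 e (quotΩ y L))).aff₀;
              ∀ ⦃T : SchemeOver (geomResidueField w)⦄ (t : T ⟶ (𝔡 (red₀Of S Kc 𝓜 w h𝓨 e y)).G₀),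
                ∃ s : T ⟶ specOver (geomResidueField w) (Alg (𝔡 (red₀Of S Kc 𝓜 w h𝓨 e (quotΩ y L))).G₀ ⧸ (spGeoOf I 𝔡 (quotΩ y L) Lb).1),
                  s ≫ quotIncl (𝔡 (red₀Of S Kc 𝓜 w h𝓨 e (quotΩ y L))).G₀ (spGeoOf I 𝔡 (quotΩ y L) Lb).1 ≫ (𝔡 (red₀Of S Kc 𝓜 w h𝓨 e (quotΩ y L))).ι₀G ≫
                      baseChangeHom (baseChangeHom (serreTranslate I.act E' hE' P) (pullback.fst (𝓜.localise w).total.hom (specResidueField w))) (red₀Of S Kc 𝓜 w h𝓨 e (quotΩ y L)).left =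
                    t ≫ (𝔡 (red₀Of S Kc 𝓜 w h𝓨 e y)).ι₀G ≫ ψ))
    -- ═════ (RKG) HEAD `hrkG_of_dock` (A-p06 (g36) 1314fd74 ∕ ★ p850494; my (C6′) `hrkG` text under `∀ 𝔡 xbar`).  Fed at fold by `hrkG_of_dock I`.
    (hrkG : ∀ (𝔡 : ∀ xbar, DockAt I xbar) (xbar : AlgPoints (𝓜.localise w).reductionAt (geomResidueField w))
      (G' : SchemeOver (geomResidueField w)) [GrpObj G'] [IsAffine G'.left] [Module.Finite (geomResidueField w) (Alg G')]
      (j' : G' ⟶ (sch₀Of 𝓜 w I.univ xbar).X) [IsMonHom j'] [IsClosedImmersion j'.left],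
      (∀ ⦃T : SchemeOver (geomResidueField w)⦄ (t : T ⟶ (sch₀Of 𝓜 w I.univ xbar).X),
        (∃ s : T ⟶ G', s ≫ j' = t) ↔ ∀ a ∈ w.asIdeal * ((IsCMField.complexConj F) • w).asIdeal, t ≫ (act₀Of 𝓜 w I.univ I.act a xbar).hom.hom.hom = 1) →
      Module.finrank (geomResidueField w) (Alg G') = (I.pChar ^ I.fDeg * I.pChar ^ I.fDeg) * (I.pChar ^ I.fDeg * I.pChar ^ I.fDeg))
    -- ═════ (ρ3-K) HEAD `exists_isogW₀_of_quotLeg` (LA2-p03 (g3) f3424bb3 :171 VERBATIM: general `(xbar xbar″ ψ)` currency; (LAYER) ∧ HOM ∧ EQUIV ∧ (KER) ∧ UNIQ).  Fed at fold by `exists_isogW₀_of_quotLeg I`.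
    (hK1 : ∀ {m : ℕ} (E' : Matrix (Fin m) (Fin m) (𝓞 F)) (hE' : E' * E' = E') (P : Matrix (Fin m) (Fin 1) (𝓞 F)) (Q : Matrix (Fin 1) (Fin m) (𝓞 F))
      (hP : E' * P = P) (hQ : Q * E' = Q) (hQP : Q * P = Matrix.scalar (Fin 1) (I.pChar : 𝓞 F))
      (hPQ : P * Q = Matrix.scalar (Fin m) (I.pChar : 𝓞 F) * E') (h𝔭 : Ideal.span (Set.range fun k => P k 0) = w.asIdeal)
      (𝔡 : ∀ xbar, DockAt I xbar) (xbar xbar'' : AlgPoints (𝓜.localise w).reductionAt (geomResidueField w))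
      (ψ : (sch₀Of 𝓜 w I.univ xbar).X ⟶ (sch₀Of 𝓜 w (serreTensor I.act E' hE') xbar'').X) [IsMonHom ψ]
      (hact : ∀ a : 𝓞 F, (act₀Of 𝓜 w I.univ I.act a xbar).hom.hom.hom ≫ ψ =
        ψ ≫ (act₀Of 𝓜 w (serreTensor I.act E' hE') (serreAction I.act E' hE') a xbar'').hom.hom.hom),
      letI := (𝔡 xbar).grp₀; letI := (𝔡 xbar'').grp₀
      ∃ φ : (𝔡 xbar).G₀ ⟶ (𝔡 xbar'').G₀,
        -- (LAYER) the square through the cover pin — ★ (ρ3a)՚s `hover` with `ι₂ := (𝔡 x̄″).ι₀G ≫ c̄_{x̄″}`, `ι₁ := (𝔡 x̄).ι₀G`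
        φ ≫ (𝔡 xbar'').ι₀G ≫
            baseChangeHom (baseChangeHom (serreTranslate I.act E' hE' P) (pullback.fst (𝓜.localise w).total.hom (specResidueField w))) xbar''.left =
          (𝔡 xbar).ι₀G ≫ ψ ∧
        -- `IsogHomLaw` letter
        IsMonHom φ ∧
        -- `𝒪_F`-equivariance on the docks
        (∀ a : 𝓞 F, (𝔡 xbar).β₀ a ≫ φ = φ ≫ (𝔡 xbar'').β₀ a) ∧
        -- (KER) the kernel of `φ` on all `T`-points is the kernel of `ι₀G ≫ ψ`
        (∀ ⦃T : SchemeOver (geomResidueField w)⦄ (j : T ⟶ (𝔡 xbar).G₀), j ≫ φ = 1 ↔ j ≫ (𝔡 xbar).ι₀G ≫ ψ = 1) ∧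
        -- UNIQUENESS over (LAYER)
        ∀ φ' : (𝔡 xbar).G₀ ⟶ (𝔡 xbar'').G₀,
          φ' ≫ (𝔡 xbar'').ι₀G ≫
              baseChangeHom (baseChangeHom (serreTranslate I.act E' hE' P) (pullback.fst (𝓜.localise w).total.hom (specResidueField w))) xbar''.left =
            (𝔡 xbar).ι₀G ≫ ψ → φ' = φ)
    -- ═════ (ρ3-K) `mono_coverPin₀` (LA2-p03 (g3) f3424bb3 :131 VERBATIM: the cover pin `ι₀G(x̄″) ≫ c̄_{x̄″}` is a monomorphism).  Fed at fold by `mono_coverPin₀ I`.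
    (hMono : ∀ {m : ℕ} (E' : Matrix (Fin m) (Fin m) (𝓞 F)) (hE' : E' * E' = E') (P : Matrix (Fin m) (Fin 1) (𝓞 F)) (Q : Matrix (Fin 1) (Fin m) (𝓞 F))
      (hP : E' * P = P) (hQ : Q * E' = Q) (hQP : Q * P = Matrix.scalar (Fin 1) (I.pChar : 𝓞 F))
      (hPQ : P * Q = Matrix.scalar (Fin m) (I.pChar : 𝓞 F) * E') (h𝔭 : Ideal.span (Set.range fun k => P k 0) = w.asIdeal)
      (𝔡 : ∀ xbar, DockAt I xbar) (xbar'' : AlgPoints (𝓜.localise w).reductionAt (geomResidueField w)),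
      Mono ((𝔡 xbar'').ι₀G ≫
          baseChangeHom (baseChangeHom (serreTranslate I.act E' hE' P) (pullback.fst (𝓜.localise w).total.hom (specResidueField w))) xbar''.left :
        (𝔡 xbar'').G₀ ⟶ (sch₀Of 𝓜 w (serreTensor I.act E' hE') xbar'').X))
    -- ═════ (ρ3-K) (K3) `le_ker_isogW₀_of_himg` (LA2-p03 (g3) f3424bb3 :270 VERBATIM: the (IMG) row puts `H″` below `ker Γ(φ)`).  Fed at fold by `le_ker_isogW₀_of_himg I`.
    (hK3 : ∀ {m : ℕ} (E' : Matrix (Fin m) (Fin m) (𝓞 F)) (hE' : E' * E' = E') (P : Matrix (Fin m) (Fin 1) (𝓞 F)) (Q : Matrix (Fin 1) (Fin m) (𝓞 F))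
      (hP : E' * P = P) (hQ : Q * E' = Q) (hQP : Q * P = Matrix.scalar (Fin 1) (I.pChar : 𝓞 F))
      (hPQ : P * Q = Matrix.scalar (Fin m) (I.pChar : 𝓞 F) * E') (h𝔭 : Ideal.span (Set.range fun k => P k 0) = w.asIdeal)
      (𝔡 : ∀ xbar, DockAt I xbar) (xbar xbar'' : AlgPoints (𝓜.localise w).reductionAt (geomResidueField w))
      (ψ : (sch₀Of 𝓜 w I.univ xbar).X ⟶ (sch₀Of 𝓜 w (serreTensor I.act E' hE') xbar'').X)
      (φ : (𝔡 xbar).G₀ ⟶ (𝔡 xbar'').G₀)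
      (hlayer : φ ≫ (𝔡 xbar'').ι₀G ≫
          baseChangeHom (baseChangeHom (serreTranslate I.act E' hE' P) (pullback.fst (𝓜.localise w).total.hom (specResidueField w))) xbar''.left =
        (𝔡 xbar).ι₀G ≫ ψ)
      (H'' : SubOf I 𝔡 xbar'')
      (himg : letI := (𝔡 xbar'').grp₀; haveI := (𝔡 xbar'').aff₀;
        ∀ ⦃T : SchemeOver (geomResidueField w)⦄ (t : T ⟶ (𝔡 xbar).G₀),
          ∃ s : T ⟶ specOver (geomResidueField w) (Alg (𝔡 xbar'').G₀ ⧸ H''.1),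
            s ≫ quotIncl (𝔡 xbar'').G₀ H''.1 ≫ (𝔡 xbar'').ι₀G ≫
                baseChangeHom (baseChangeHom (serreTranslate I.act E' hE' P) (pullback.fst (𝓜.localise w).total.hom (specResidueField w))) xbar''.left =
              t ≫ (𝔡 xbar).ι₀G ≫ ψ),
      letI := (𝔡 xbar'').grp₀; haveI := (𝔡 xbar'').aff₀;
      (∃ s : (𝔡 xbar).G₀ ⟶ specOver (geomResidueField w) (Alg (𝔡 xbar'').G₀ ⧸ H''.1), s ≫ quotIncl (𝔡 xbar'').G₀ H''.1 = φ) ∧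
        H''.1 ≤ (RingHom.ker φ.left.appTop.hom : Ideal (Alg (𝔡 xbar'').G₀)))
    -- ═════ [WQ] HEAD `red₀Of_quotΩ_eq_of_quotLegReduction₀` (LA6-p01 (g3) v3lite d0c25590 :836–:899 VERBATIM, (Δ1)–(Δ3) included).  Fed at fold by `red₀Of_quotΩ_eq_of_quotLegReduction₀ I`.
    (hWQ : ∀ {m : ℕ} (E' : Matrix (Fin m) (Fin m) (𝓞 F)) (hE' : E' * E' = E') (P : Matrix (Fin m) (Fin 1) (𝓞 F)) (Q : Matrix (Fin 1) (Fin m) (𝓞 F))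
    (hP : E' * P = P) (hQ : Q * E' = Q) (hQP : Q * P = Matrix.scalar (Fin 1) (I.pChar : 𝓞 F))
    (hPQ : P * Q = Matrix.scalar (Fin m) (I.pChar : 𝓞 F) * E') (h𝔭 : Ideal.span (Set.range fun k => P k 0) = w.asIdeal)
      (𝔠 : Set (𝓞 F)) (hQ𝔠 : ∀ j k, Q j k ∈ 𝔠) (h𝔠 : ∀ a ∈ 𝔠, ∃ Pa : Matrix (Fin m) (Fin 1) (𝓞 F), E' * Pa = Pa ∧ Pa * Q = a • E')
      (𝔡 : ∀ xbar, DockAt I xbar)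
      -- (RKG) the rank of `A_x̄[𝔭_w𝔭_{c•w}]`, BY VALUE for every closed realisation, at every special point (LA2-p04 (g2) (C6′) `hrkG` text under `∀ xbar`)
      (hrkG : ∀ (xbar : AlgPoints (𝓜.localise w).reductionAt (geomResidueField w))
        (G' : SchemeOver (geomResidueField w)) [GrpObj G'] [IsAffine G'.left] [Module.Finite (geomResidueField w) (Alg G')]
        (j' : G' ⟶ (sch₀Of 𝓜 w I.univ xbar).X) [IsMonHom j'] [IsClosedImmersion j'.left],
        (∀ ⦃T : SchemeOver (geomResidueField w)⦄ (t : T ⟶ (sch₀Of 𝓜 w I.univ xbar).X),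
          (∃ s : T ⟶ G', s ≫ j' = t) ↔ ∀ a ∈ w.asIdeal * ((IsCMField.complexConj F) • w).asIdeal, t ≫ (act₀Of 𝓜 w I.univ I.act a xbar).hom.hom.hom = 1) →
        Module.finrank (geomResidueField w) (Alg G') = (I.pChar ^ I.fDeg * I.pChar ^ I.fDeg) * (I.pChar ^ I.fDeg * I.pChar ^ I.fDeg))
      (quotΩ : ∀ y, LineOf I y → AlgPoints (S.M.obj Kc) (AlgebraicClosure (w.adicCompletion F)))
      (hdat : ∀ (y : AlgPoints (S.M.obj Kc) (AlgebraicClosure (w.adicCompletion F))) (L : LineOf I y),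
        haveI := I.comm
        letI := (𝔡 (red₀Of S Kc 𝓜 w h𝓨 e y)).grp₀
        haveI := (𝔡 (red₀Of S Kc 𝓜 w h𝓨 e y)).aff₀
          ∃ (ψ : (sch₀Of 𝓜 w I.univ (red₀Of S Kc 𝓜 w h𝓨 e y)).X ⟶ (sch₀Of 𝓜 w (serreTensor I.act E' hE') (red₀Of S Kc 𝓜 w h𝓨 e (quotΩ y L))).X) (_ : IsMonHom ψ),
            -- (FLAT-SURJ)
            (Flat ψ.left ∧ Function.Surjective ψ.left.base) ∧
            -- (ACT) `𝒪_F`-equivariance, `act₀Of` currency on both sides (`serreAction` on `𝒞`)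
            (∀ a : 𝓞 F, (act₀Of 𝓜 w I.univ I.act a (red₀Of S Kc 𝓜 w h𝓨 e y)).hom.hom.hom ≫ ψ =
              ψ ≫ (act₀Of 𝓜 w (serreTensor I.act E' hE') (serreAction I.act E' hE') a (red₀Of S Kc 𝓜 w h𝓨 e (quotΩ y L))).hom.hom.hom) ∧
            -- (LVL) level points: `ψ(σᵃ(x̄)) = (σᵃ ≫ ψ_P)(x̄″)`
            (∀ a : Fin I.g ⊕ Fin I.g → ZMod I.N,
              AlgPoints.map ψ (lvlPt₀Of 𝓜 w I.univ I.lvl (red₀Of S Kc 𝓜 w h𝓨 e y) a) =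
                ((serreTensor I.act E' hE').baseChange (pullback.fst (𝓜.localise w).total.hom (specResidueField w))).restrictPt (red₀Of S Kc 𝓜 w h𝓨 e (quotΩ y L)).left
                  ((serreTensor I.act E' hE').sectionBaseChange (pullback.fst (𝓜.localise w).total.hom (specResidueField w)) (I.lvl.section_ a ≫ serreTranslate I.act E' hE' P))) ∧
            -- (SIM) for EVERY downstairs dual pair of `𝒞_{x̄″}` through which the cover leg pulls back to `λ ≫ [p]`: `ψ^* λ_B̄ = λ_{x̄} ≫ [p]`
            (∀ (DBs : (sch₀Of 𝓜 w (serreTensor I.act E' hE') (red₀Of S Kc 𝓜 w h𝓨 e (quotΩ y L))).DualPair)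
              (_ : Nonempty ((Scheme.Modules.pullback (DualPair.unitHatSlice DBs)).obj DBs.P ≅ SheafOfModules.unit _))
              (lamBs : (sch₀Of 𝓜 w (serreTensor I.act E' hE') (red₀Of S Kc 𝓜 w h𝓨 e (quotΩ y L))).X ⟶ DBs.hat.X) [IsMonHom lamBs],
              (haveI := isMonHom_coverLeg (pullback.fst (𝓜.localise w).total.hom (specResidueField w)) (red₀Of S Kc 𝓜 w h𝓨 e (quotΩ y L)).left I.act E' hE' P
               baseChangeHom (baseChangeHom (serreTranslate I.act E' hE' P) (pullback.fst (𝓜.localise w).total.hom (specResidueField w))) (red₀Of S Kc 𝓜 w h𝓨 e (quotΩ y L)).left ≫ lamBs ≫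
                  DualPair.dualIsogenyOver (baseChangeHom (baseChangeHom (serreTranslate I.act E' hE' P) (pullback.fst (𝓜.localise w).total.hom (specResidueField w))) (red₀Of S Kc 𝓜 w h𝓨 e (quotΩ y L)).left)
                    (dual₀Of 𝓜 w I.univ I.dual (red₀Of S Kc 𝓜 w h𝓨 e (quotΩ y L))) DBs =
                (pol₀Of 𝓜 w I.univ I.pol (red₀Of S Kc 𝓜 w h𝓨 e (quotΩ y L))).lam ≫ (dual₀Of 𝓜 w I.univ I.dual (red₀Of S Kc 𝓜 w h𝓨 e (quotΩ y L))).hat.mulN I.pChar) →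
              ψ ≫ lamBs ≫ DualPair.dualIsogenyOver ψ (dual₀Of 𝓜 w I.univ I.dual (red₀Of S Kc 𝓜 w h𝓨 e y)) DBs =
                (pol₀Of 𝓜 w I.univ I.pol (red₀Of S Kc 𝓜 w h𝓨 e y)).lam ≫ (dual₀Of 𝓜 w I.univ I.dual (red₀Of S Kc 𝓜 w h𝓨 e y)).hat.mulN I.pChar) ∧
            -- (K2-gen) every ideal bound on the kernel descends: `Ker q(Ω̄) ⊆ A_y[𝔞](Ω̄)` for the upstairs leg is recorded through `L`'s roof, so downstairs:
            (∀ 𝔞 : Ideal (𝓞 F), (∀ Pt ∈ L.1, IsIdealTorsionΩ S Kc 𝓜 w e I.univ I.act y 𝔞 Pt) →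
              (∀ Pt : (fibreΩOf S Kc 𝓜 w e I.univ y).Points (AlgebraicClosure (w.adicCompletion F)),
                (∀ r ∈ w.asIdeal * ((IsCMField.complexConj F) • w).asIdeal, (AlgPoints.map (actΩOf S Kc 𝓜 w e I.univ I.act r y).hom.hom.hom Pt :
                  (fibreΩOf S Kc 𝓜 w e I.univ y).Points (AlgebraicClosure (w.adicCompletion F))) = 1) → IsIdealTorsionΩ S Kc 𝓜 w e I.univ I.act y 𝔞 Pt) →
              ∀ ⦃T : SchemeOver (geomResidueField w)⦄ (z : T ⟶ (sch₀Of 𝓜 w I.univ (red₀Of S Kc 𝓜 w h𝓨 e y)).X),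
                z ≫ ψ = 1 → ∀ r ∈ 𝔞, z ≫ (act₀Of 𝓜 w I.univ I.act r (red₀Of S Kc 𝓜 w h𝓨 e y)).hom.hom.hom = 1) ∧
            -- (RK) the rank of `Ker ψ`, BY VALUE for every closed realisation (LA2-p04 (g2) (C6′) `hrkᵢ` text)
            (∀ (K : SchemeOver (geomResidueField w)) [GrpObj K] [IsAffine K.left] [Module.Finite (geomResidueField w) (Alg K)]
              (κ : K ⟶ (sch₀Of 𝓜 w I.univ (red₀Of S Kc 𝓜 w h𝓨 e y)).X) [IsMonHom κ] [IsClosedImmersion κ.left],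
              (∀ ⦃T : SchemeOver (geomResidueField w)⦄ (t : T ⟶ (sch₀Of 𝓜 w I.univ (red₀Of S Kc 𝓜 w h𝓨 e y)).X), (∃ s : T ⟶ K, s ≫ κ = t) ↔ t ≫ ψ = 1) →
              Module.finrank (geomResidueField w) (Alg K) = I.pChar ^ I.fDeg * I.pChar ^ I.fDeg) ∧
            -- (KILL) `ψ` kills `V(spGeoOf y L) ↪ G₀(x̄) ↪ A_{x̄}`
            quotIncl (𝔡 (red₀Of S Kc 𝓜 w h𝓨 e y)).G₀ (spGeoOf I 𝔡 y L).1 ≫ (𝔡 (red₀Of S Kc 𝓜 w h𝓨 e y)).ι₀G ≫ ψ = 1 ∧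
            -- (DOCK) `Ker ψ ∩ G₀(x̄) = V(spGeoOf y L)` on all `T`-points of the dock
            ∀ ⦃T : SchemeOver (geomResidueField w)⦄ (t : T ⟶ (𝔡 (red₀Of S Kc 𝓜 w h𝓨 e y)).G₀),
              t ≫ (𝔡 (red₀Of S Kc 𝓜 w h𝓨 e y)).ι₀G ≫ ψ = 1 ↔
                ∃ s : T ⟶ specOver (geomResidueField w) (Alg (𝔡 (red₀Of S Kc 𝓜 w h𝓨 e y)).G₀ ⧸ (spGeoOf I 𝔡 y L).1),
                  s ≫ quotIncl (𝔡 (red₀Of S Kc 𝓜 w h𝓨 e y)).G₀ (spGeoOf I 𝔡 y L).1 = t)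
      (hunr : ¬ (w.asIdeal ^ 2 ∣ Ideal.span {(I.pChar : 𝓞 F)}))
      (hpN : Nat.Coprime I.pChar I.N)
      (y y' : AlgPoints (S.M.obj Kc) (AlgebraicClosure (w.adicCompletion F))) (L : LineOf I y) (L' : LineOf I y')
      (h : red₀Of S Kc 𝓜 w h𝓨 e y = red₀Of S Kc 𝓜 w h𝓨 e y') (hsp : h ▸ spGeoOf I 𝔡 y L = spGeoOf I 𝔡 y' L'),
      red₀Of S Kc 𝓜 w h𝓨 e (quotΩ y L) = red₀Of S Kc 𝓜 w h𝓨 e (quotΩ y' L'))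
    -- ═════ (T-WD) HEAD `red₀Of_translΩ_eq_of_red₀Of_eq` (LA6-p01 (g2) 70de5998 :305 VERBATIM).  Fed at fold by `red₀Of_translΩ_eq_of_red₀Of_eq I`.
    (hTWD : ∀ (translΩ : AlgPoints (S.M.obj Kc) (AlgebraicClosure (w.adicCompletion F)) → AlgPoints (S.M.obj Kc) (AlgebraicClosure (w.adicCompletion F)))
      (hroof₂ : RoofLink₂ I translΩ) (hpN : Nat.Coprime I.pChar I.N)
      {y₁ y₂ : AlgPoints (S.M.obj Kc) (AlgebraicClosure (w.adicCompletion F))} (h : red₀Of S Kc 𝓜 w h𝓨 e y₁ = red₀Of S Kc 𝓜 w h𝓨 e y₂),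
      red₀Of S Kc 𝓜 w h𝓨 e (translΩ y₁) = red₀Of S Kc 𝓜 w h𝓨 e (translΩ y₂))
    -- ═════ D6 DOWNSTAIRS HEAD `red₀Of_quotΩ_eq_red₀Of_translΩ_of_le_ker_layer` (LA6-p01 (g3) 2673ec94 :145 VERBATIM, two-lift form, eats `Lb hLb hbt`).  Fed at fold by `red₀Of_quotΩ_eq_red₀Of_translΩ_of_le_ker_layer I`.
    (hD6 : ∀ {m : ℕ} (E' : Matrix (Fin m) (Fin m) (𝓞 F)) (hE' : E' * E' = E') (P : Matrix (Fin m) (Fin 1) (𝓞 F))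
      (𝔡 : ∀ xbar, DockAt I xbar)
      (quotΩ : ∀ y, LineOf I y → AlgPoints (S.M.obj Kc) (AlgebraicClosure (w.adicCompletion F)))
      (translΩ : AlgPoints (S.M.obj Kc) (AlgebraicClosure (w.adicCompletion F)) → AlgPoints (S.M.obj Kc) (AlgebraicClosure (w.adicCompletion F)))
      -- [WQ] two-lift form for `sp := spGeoOf I 𝔡` (the (C6α) fold `red₀Of_quotΩ_eq_of_quotLegReduction₀` with its data fixed)
      (hWQ : ∀ (y y' : AlgPoints (S.M.obj Kc) (AlgebraicClosure (w.adicCompletion F))) (L : LineOf I y) (L' : LineOf I y')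
        (h : red₀Of S Kc 𝓜 w h𝓨 e y = red₀Of S Kc 𝓜 w h𝓨 e y'),
        h ▸ spGeoOf I 𝔡 y L = spGeoOf I 𝔡 y' L' → red₀Of S Kc 𝓜 w h𝓨 e (quotΩ y L) = red₀Of S Kc 𝓜 w h𝓨 e (quotΩ y' L'))
      (y : AlgPoints (S.M.obj Kc) (AlgebraicClosure (w.adicCompletion F))) (L : LineOf I y)
      -- the reduced `𝒞`-leg at `(y, L)` ((ρ1𝒞)) with its (DOCK) row VERBATIM
      (ψ : haveI := I.comm
        (sch₀Of 𝓜 w I.univ (red₀Of S Kc 𝓜 w h𝓨 e y)).X ⟶ (sch₀Of 𝓜 w (serreTensor I.act E' hE') (red₀Of S Kc 𝓜 w h𝓨 e (quotΩ y L))).X)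
      (hdock : letI := (𝔡 (red₀Of S Kc 𝓜 w h𝓨 e y)).grp₀; haveI := (𝔡 (red₀Of S Kc 𝓜 w h𝓨 e y)).aff₀;
        ∀ ⦃T : SchemeOver (geomResidueField w)⦄ (t : T ⟶ (𝔡 (red₀Of S Kc 𝓜 w h𝓨 e y)).G₀),
          t ≫ (𝔡 (red₀Of S Kc 𝓜 w h𝓨 e y)).ι₀G ≫ ψ = 1 ↔
            ∃ s : T ⟶ specOver (geomResidueField w) (Alg (𝔡 (red₀Of S Kc 𝓜 w h𝓨 e y)).G₀ ⧸ (spGeoOf I 𝔡 y L).1),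
              s ≫ quotIncl (𝔡 (red₀Of S Kc 𝓜 w h𝓨 e y)).G₀ (spGeoOf I 𝔡 y L).1 = t)
      -- the layer map OVER `ψ` THROUGH THE COVER PIN ((ρ3-K)), a homomorphism; the pin a monomorphism (`mono_coverPin₀`)
      (φ : (𝔡 (red₀Of S Kc 𝓜 w h𝓨 e y)).G₀ ⟶ (𝔡 (red₀Of S Kc 𝓜 w h𝓨 e (quotΩ y L))).G₀)
      (hφ : letI := (𝔡 (red₀Of S Kc 𝓜 w h𝓨 e y)).grp₀; letI := (𝔡 (red₀Of S Kc 𝓜 w h𝓨 e (quotΩ y L))).grp₀; IsMonHom φ)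
      (hpin : haveI := I.comm
        Mono ((𝔡 (red₀Of S Kc 𝓜 w h𝓨 e (quotΩ y L))).ι₀G ≫
          baseChangeHom (baseChangeHom (serreTranslate I.act E' hE' P) (pullback.fst (𝓜.localise w).total.hom (specResidueField w))) (red₀Of S Kc 𝓜 w h𝓨 e (quotΩ y L)).left))
      (hover : haveI := I.comm
        φ ≫ (𝔡 (red₀Of S Kc 𝓜 w h𝓨 e (quotΩ y L))).ι₀G ≫
            baseChangeHom (baseChangeHom (serreTranslate I.act E' hE' P) (pullback.fst (𝓜.localise w).total.hom (specResidueField w))) (red₀Of S Kc 𝓜 w h𝓨 e (quotΩ y L)).left =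
          (𝔡 (red₀Of S Kc 𝓜 w h𝓨 e y)).ι₀G ≫ ψ)
      -- the NAMED backtracking line: below the kernel ((IMG) + (ρ3-K)) and Hecke-backtracking ((H4′)∕★ HBT)
      (Lb : LineOf I (quotΩ y L))
      (hLb : letI := (𝔡 (red₀Of S Kc 𝓜 w h𝓨 e (quotΩ y L))).grp₀; haveI := (𝔡 (red₀Of S Kc 𝓜 w h𝓨 e (quotΩ y L))).aff₀;
        (spGeoOf I 𝔡 (quotΩ y L) Lb).1 ≤ (RingHom.ker φ.left.appTop.hom : Ideal (Alg (𝔡 (red₀Of S Kc 𝓜 w h𝓨 e (quotΩ y L))).G₀)))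
      (hbt : quotΩ (quotΩ y L) Lb = translΩ y)
      -- D6's hypothesis letter and a second lift of `(x̄″, H′)`
      (H' : SubOf I 𝔡 (red₀Of S Kc 𝓜 w h𝓨 e (quotΩ y L)))
      (hle : letI := (𝔡 (red₀Of S Kc 𝓜 w h𝓨 e (quotΩ y L))).grp₀; haveI := (𝔡 (red₀Of S Kc 𝓜 w h𝓨 e (quotΩ y L))).aff₀;
        H'.1 ≤ (RingHom.ker φ.left.appTop.hom : Ideal (Alg (𝔡 (red₀Of S Kc 𝓜 w h𝓨 e (quotΩ y L))).G₀)))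
      (y₂ : AlgPoints (S.M.obj Kc) (AlgebraicClosure (w.adicCompletion F))) (L₂ : LineOf I y₂)
      (h₂ : red₀Of S Kc 𝓜 w h𝓨 e y₂ = red₀Of S Kc 𝓜 w h𝓨 e (quotΩ y L)) (hsp₂ : h₂ ▸ spGeoOf I 𝔡 y₂ L₂ = H'),
      red₀Of S Kc 𝓜 w h𝓨 e (quotΩ y₂ L₂) = red₀Of S Kc 𝓜 w h𝓨 e (translΩ y)) :
    ∃ (sp : ∀ y, LineOf I y → SubOf I 𝔡 (red₀Of S Kc 𝓜 w h𝓨 e y))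
      (quot : ∀ xbar, SubOf I 𝔡 xbar → AlgPoints (𝓜.localise w).reductionAt (geomResidueField w))
      (transl : AlgPoints (𝓜.localise w).reductionAt (geomResidueField w) → AlgPoints (𝓜.localise w).reductionAt (geomResidueField w))
      (isogW₀ : ∀ xbar (H : SubOf I 𝔡 xbar), (𝔡 xbar).G₀ ⟶ (𝔡 (quot xbar H)).G₀),
      RedQuotLaw I 𝔡 quotΩ sp quot ∧ RedTranslLaw S Kc 𝓜 w h𝓨 e translΩ transl ∧ CanonicalLineLaw I 𝔡 sp ∧ SpSurjLaw I 𝔡 sp ∧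
      IsogHomLaw I 𝔡 quot isogW₀ ∧ IsogKerLaw I 𝔡 quot isogW₀ ∧ QuotQuot₀Law I 𝔡 quot transl isogW₀ := by
  classical
  haveI := I.comm
  -- ── Serre letters for `𝔭_w` with scalar EXACTLY `p` (★ `exists_serrePresentation_of_ideal_of_natCast_mem`)
  obtain ⟨m, E', hE', P, Q, hP, hQ, hQP, hPQ, h𝔭, hQ𝔠, h𝔠⟩ :=
    Literature.NumberTheory.NumberFields.SerrePresentation.exists_serrePresentation_of_ideal_of_natCast_mem
      w.asIdeal w.ne_bot (N := I.pChar) I.hpChar.2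
  -- ── `p ∤ N` at any special point (★ p850254; `0 < g` from `I.hg`)
  have hpN_of : AlgPoints (S.M.obj Kc) (AlgebraicClosure (w.adicCompletion F)) → Nat.Coprime I.pChar I.N := fun y =>
    haveI : Fact I.pChar.Prime := ⟨I.hpChar.1⟩
    haveI := I.charP₀
    I.lvl.coprime_of_charP (spPt 𝓜 w (red₀Of S Kc 𝓜 w h𝓨 e y)) I.relDim (by rw [I.hg]; exact Module.finrank_pos) I.pChar
  -- ── [WQ] with `hdat` := the (ρ1𝒞) rows minus (IMG)
  have hWQ' : ∀ (y y' : AlgPoints (S.M.obj Kc) (AlgebraicClosure (w.adicCompletion F))) (L : LineOf I y) (L' : LineOf I y')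
      (h : red₀Of S Kc 𝓜 w h𝓨 e y = red₀Of S Kc 𝓜 w h𝓨 e y') (hsp : h ▸ spGeoOf I 𝔡 y L = spGeoOf I 𝔡 y' L'),
      red₀Of S Kc 𝓜 w h𝓨 e (quotΩ y L) = red₀Of S Kc 𝓜 w h𝓨 e (quotΩ y' L') := fun y y' L L' h hsp =>
    hWQ E' hE' P Q hP hQ hQP hPQ h𝔭 _ hQ𝔠 h𝔠 𝔡 (hrkG 𝔡) quotΩ
      (fun y L => exists₂_dropLast (hρ1 𝔡 quotΩ translΩ hhecke hroof hroof₂ hunit hKc E' hE' P Q hP hQ hQP hPQ h𝔭 y L)) I.hunr (hpN_of y) y y' L L' h hsp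
  -- ── KEY₂: the special translation, with its OFF and ON clauses
  have key₂ : ∀ xbar : AlgPoints (𝓜.localise w).reductionAt (geomResidueField w), ∃ t : AlgPoints (𝓜.localise w).reductionAt (geomResidueField w),
      ((¬ ∃ y, red₀Of S Kc 𝓜 w h𝓨 e y = xbar) → t = xbar) ∧ ∀ y, red₀Of S Kc 𝓜 w h𝓨 e y = xbar → t = red₀Of S Kc 𝓜 w h𝓨 e (translΩ y) := by
    intro xbar
    by_cases hx : ∃ y, red₀Of S Kc 𝓜 w h𝓨 e y = xbar
    · obtain ⟨y₀, hy₀⟩ := hx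
      exact ⟨red₀Of S Kc 𝓜 w h𝓨 e (translΩ y₀), fun h => (h ⟨y₀, hy₀⟩).elim,
        fun y hy => hTWD translΩ hroof₂ (hpN_of y₀) (hy₀.trans hy.symm)⟩
    · exact ⟨xbar, fun _ => rfl, fun y hy => (hx ⟨y, hy⟩).elim⟩
  choose transl htransl_off htransl_on using key₂
  -- ── KEY in `y₀`-currency (ON the sheet): `subst` the two equation binders, then no object is ever transported
  -- ── KEY in `y₀`-currency (ON the sheet): the split-off `stub_SPEC_keyOn`
  have key_on := stub_SPEC_keyOn I 𝔡 quotΩ translΩ hhecke hroof hroof₂ hunit hKc E' hE' P Q hP hQ hQP hPQ h𝔭 hρ1 hK1 hMono hK3 hTWD hD6 hWQ'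
  have KEY : ∀ (x : AlgPoints (𝓜.localise w).reductionAt (geomResidueField w)) (H : SubOf I 𝔡 x),
      ∃ (q : AlgPoints (𝓜.localise w).reductionAt (geomResidueField w)) (φ : (𝔡 x).G₀ ⟶ (𝔡 q).G₀),
        (letI := (𝔡 x).grp₀; letI := (𝔡 q).grp₀; IsMonHom φ) ∧
        (letI := (𝔡 x).grp₀; haveI := (𝔡 x).aff₀; letI := (𝔡 q).grp₀; quotIncl (𝔡 x).G₀ H.1 ≫ φ = 1) ∧
        ((¬ ∃ y, red₀Of S Kc 𝓜 w h𝓨 e y = x) → q = x) ∧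
        (∀ (y : AlgPoints (S.M.obj Kc) (AlgebraicClosure (w.adicCompletion F))) (L : LineOf I y) (hx' : red₀Of S Kc 𝓜 w h𝓨 e y = x), hx' ▸ spGeoOf I 𝔡 y L = H → q = red₀Of S Kc 𝓜 w h𝓨 e (quotΩ y L)) ∧
        (∀ H' : SubOf I 𝔡 q,
          (letI := (𝔡 q).grp₀; haveI := (𝔡 q).aff₀; H'.1 ≤ (RingHom.ker φ.left.appTop.hom : Ideal (Alg (𝔡 q).G₀))) →
          ∀ y₃ : AlgPoints (S.M.obj Kc) (AlgebraicClosure (w.adicCompletion F)), red₀Of S Kc 𝓜 w h𝓨 e y₃ = x →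
            ∀ (y₂ : AlgPoints (S.M.obj Kc) (AlgebraicClosure (w.adicCompletion F))) (L₂ : LineOf I y₂) (hx₂ : red₀Of S Kc 𝓜 w h𝓨 e y₂ = q), hx₂ ▸ spGeoOf I 𝔡 y₂ L₂ = H' →
              red₀Of S Kc 𝓜 w h𝓨 e (quotΩ y₂ L₂) = red₀Of S Kc 𝓜 w h𝓨 e (translΩ y₃)) := by
    intro x H
    exact if hx : ∃ y, red₀Of S Kc 𝓜 w h𝓨 e y = x then
        hx.elim fun y₀ hy₀ => (exists_line_of_eq I 𝔡 y₀ hy₀ H).elim fun L₀ hL₀ => key_on y₀ L₀ x hy₀ H hL₀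
      else
        letI := (𝔡 x).grp₀
        haveI := (𝔡 x).aff₀
        ⟨x, 1, isMonHom_one, MonObj.comp_one _, fun _ => rfl, fun y L hx' _ => (hx ⟨y, hx'⟩).elim,
          fun H' _ y₃ hy₃ => (hx ⟨y₃, hy₃⟩).elim⟩
  choose quot isogW₀ hmon hkerq hoff hquot hqq using KEY
  refine ⟨spGeoOf I 𝔡, quot, transl, isogW₀, ?_, ?_, ?_, ?_, ?_, ?_, ?_⟩
  · -- (c2) `RedQuotLaw`
    intro y L
    exact (hquot (red₀Of S Kc 𝓜 w h𝓨 e y) (spGeoOf I 𝔡 y L) y L rfl rfl).symm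
  · -- (c2) `RedTranslLaw`
    intro y
    exact (htransl_on (red₀Of S Kc 𝓜 w h𝓨 e y) y rfl).symm
  · -- (b4′) `CanonicalLineLaw`
    exact canonicalLine_spGeoOf I 𝔡
  · -- (SP-surj) `SpSurjLaw`
    exact spGeoOf_surjective I 𝔡
  · -- `IsogHomLaw`
    intro xbar H
    exact hmon xbar H
  · -- `IsogKerLaw`
    intro xbar H
    exact hkerq xbar H
  · -- D6 `QuotQuot₀Law`
    intro xbar H H' hle
    by_cases hx : ∃ y, red₀Of S Kc 𝓜 w h𝓨 e y = xbar
    · obtain ⟨y₃, hy₃⟩ := hx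
      obtain ⟨L₃, hL₃⟩ := exists_line_of_eq I 𝔡 y₃ hy₃ H
      have hq : quot xbar H = red₀Of S Kc 𝓜 w h𝓨 e (quotΩ y₃ L₃) := hquot xbar H y₃ L₃ hy₃ hL₃
      obtain ⟨L₂, hL₂⟩ := exists_line_of_eq I 𝔡 (quotΩ y₃ L₃) hq.symm H'
      rw [hquot (quot xbar H) H' (quotΩ y₃ L₃) L₂ hq.symm hL₂, htransl_on xbar y₃ hy₃]
      exact hqq xbar H H' hle y₃ hy₃ (quotΩ y₃ L₃) L₂ hq.symm hL₂
    · have hq : quot xbar H = xbar := hoff xbar H hx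
      have hx' : ¬ ∃ y, red₀Of S Kc 𝓜 w h𝓨 e y = quot xbar H := by rw [hq]; exact hx
      rw [hoff (quot xbar H) H' hx', hq, htransl_off xbar hx]

end SpecAssembly

end Summit.HodgeConjecture.HodgeConjecture.Cruxes.HLiu418.F0P6aStubDOWN
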